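import Summits.BirchSwinnertonDyer.BirchSwinnertonDyer.Theorems.CyclotomicUntwistDescendedFrobeniusVerschiebung
import HarnessLib

/-!
# Route `CyclotomicUntwist`: Katz's Theorem 5.1.4 for the Verschiebung lift `ν` — for a good model `E ≡ V₀ (mod ϖ)`
# over `𝓞 = 𝓞_{ℚ₃(ζ₉)}` and a class `f` of `D(Ê/𝓞)_ℚ`, the series `f ∘ ν` is a class of `D(V̂₀ ⊗ 𝓞/𝓞)_ℚ`

Cell `pub/bsd-wall` (D-0145 line `route-BirchSwinnertonDyer-CyclotomicUntwist`), prover seat `bsd-line-cycu-p2`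
(gen 6), lane «D5»; sequel of `…DescendedFrobeniusVerschiebung` (`[−9]_E ≡ ν(z⁹)`, `ν` a homomorphism mod `3`) and
`…TransferSemantics` (Katz's Key Lemma over `𝓞`). THEOREMS ONLY (no definition, no named fact, no `sorry`); helper
`--supports` K1 = stmt-BirchSwinnertonDyer-21580. BSD is not proved by this file and no crux is.

CURRENCY. A series `f ∈ L⟦z⟧` (`L = ℚ₃(ζ₉)`) is a class of `D(Ĝ/𝓞)_ℚ` with exponent `B` when `3ᴮ·n·[zⁿ]f ∈ 𝓞` for all
`n` (bounded denominators of `df`) and `3ᴮ·∂_Ĝ f ∈ 𝓞⟦X,Y⟧` (`∂_Ĝ f = f(Ĝ(X,Y)) − f(X) − f(Y)`); integrality over `𝓞` is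
`IsIntegral ℤ₃` in `L` (`𝓞 = integralClosure ℤ₃ L`).
* §1 `isIntegral_mvCoeff_subst_sub_subst_K`: Katz's Key Lemma 5.1.3 for `L`-valued `f` (`U ≡ V (mod 3)` ⟹
  `3ᴮ(f(U) − f(V))` integral); `isIntegral_coeff_mvSubst_of_map`: substituting `𝓞`-series preserves `3ᴮ`-integrality.
* §2 **`f ∘ ν ∈ D(V̂₀ ⊗ 𝓞/𝓞)_ℚ`** (Katz 5.1.4 for the pointed map `ν`, a homomorphism modulo the divided-power ideal
  `(3)`): `isIntegral_natCast_mul_coeff_subst_verschiebung` (`d(f∘ν) = f′(ν)·ν′`), **`isIntegral_coeff_coboundary_verschiebung`**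
  (`∂_{G₀}(f∘ν) = [f(ν(G₀)) − f(Ĝ(ν,ν))] + (∂_Ĝ f)(ν X, ν Y)`).
Sequel `…VerschiebungSurjective`: `(f∘ν)(z⁹) + 9·f ≡ 0` and the surjectivity statement `exists_transfer_preimage`.
[cite: Katz1981CrystallineDieudonne, §5 Key Lemma 5.1.3, Thm 5.1.4] [cite: BerthelotOgus1983, Thm. 2.4 (proof)]
-/

set_option autoImplicit false
-- single-conjunct summit: `Summit.BirchSwinnertonDyer.BirchSwinnertonDyer.…` repeats the name by design
set_option linter.dupNamespace false

noncomputable section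

open PowerSeries Literature.RingTheory.FormalGroups Literature.NumberTheory.EllipticCurves
  Literature.NumberTheory.EllipticCurves.DescendedFrobenius

namespace Summit.BirchSwinnertonDyer.BirchSwinnertonDyer.Theorems.DescendedFrobeniusTransfer

/-! ## §1 Integrality bookkeeping and Katz's Key Lemma for `L`-valued series -/

/-- Coefficients of an `𝓞`-series read in `L` are integral. [folklore] -/
theorem isIntegral_coeff_map_ONine {σ : Type*} (Ψ : MvPowerSeries σ ONine) (d : σ →₀ ℕ) :
    IsIntegral ℤ_[3] (MvPowerSeries.coeff d (Ψ.map (algebraMap ONine KNine))) := by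
  rw [MvPowerSeries.coeff_map]
  exact (MvPowerSeries.coeff d Ψ).2

/-- An `L`-series with integral coefficients comes from an `𝓞`-series. [folklore] -/
theorem exists_eq_map_of_isIntegral {σ : Type*} {Φ : MvPowerSeries σ KNine}
    (h : ∀ d, IsIntegral ℤ_[3] (MvPowerSeries.coeff d Φ)) :
    ∃ Ψ : MvPowerSeries σ ONine, Ψ.map (algebraMap ONine KNine) = Φ := by
  refine ⟨fun d ↦ ⟨MvPowerSeries.coeff d Φ, h d⟩, ?_⟩
  ext d
  rw [MvPowerSeries.coeff_map]
  rfl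

/-- One-variable version of `exists_eq_map_of_isIntegral`. [folklore] -/
theorem exists_eq_map_of_isIntegral' {φ : KNine⟦X⟧} (h : ∀ n, IsIntegral ℤ_[3] (PowerSeries.coeff n φ)) :
    ∃ ψ : ONine⟦X⟧, PowerSeries.map (algebraMap ONine KNine) ψ = φ := by
  refine ⟨PowerSeries.mk fun n ↦ ⟨PowerSeries.coeff n φ, h n⟩, ?_⟩
  ext n
  rw [PowerSeries.coeff_map, PowerSeries.coeff_mk]
  rfl

/-- `(map φ f)' = map φ f'`. [folklore] -/
theorem derivative_map_eq {R S : Type*} [CommRing R] [CommRing S] (φ : R →+* S) (f : R⟦X⟧) :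
    d⁄dX S (PowerSeries.map φ f) = PowerSeries.map φ (d⁄dX R f) := by
  ext n
  simp [PowerSeries.coeff_derivative, PowerSeries.coeff_map]

/-- **Katz's Key Lemma 5.1.3 for `L`-valued series.** `3ᴮ·n·[zⁿ]f ∈ 𝓞` for all `n`, `U, V ∈ 𝓞⟦σ⟧` without constant
term, `U ≡ V (mod 3𝓞⟦σ⟧)` ⟹ `3ᴮ·(f(U) − f(V))` has `𝓞`-integral coefficients (`f(U) − f(V) = Σ f_m (Uᵐ − Vᵐ)`,
`m·3 ∣ Uᵐ − Vᵐ`). [cite: Katz1981CrystallineDieudonne, §5 Key Lemma 5.1.3] -/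
theorem isIntegral_mvCoeff_subst_sub_subst_K {σ : Type*} {f : KNine⟦X⟧} {B : ℕ}
    (hf : ∀ n : ℕ, IsIntegral ℤ_[3] ((3 : KNine) ^ B * ((n : KNine) * PowerSeries.coeff n f)))
    {U V : MvPowerSeries σ ONine} (hU0 : MvPowerSeries.constantCoeff U = 0) (hV0 : MvPowerSeries.constantCoeff V = 0)
    (hUV : MvPowerSeries.C (3 : ONine) ∣ U - V) (d : σ →₀ ℕ) :
    IsIntegral ℤ_[3] ((3 : KNine) ^ B * MvPowerSeries.coeff d
      (f.subst (U.map (algebraMap ONine KNine)) - f.subst (V.map (algebraMap ONine KNine)))) := by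
  have hU0' : MvPowerSeries.constantCoeff (U.map (algebraMap ONine KNine)) = 0 := by
    rw [MvPowerSeries.constantCoeff_map, hU0, map_zero]
  have hV0' : MvPowerSeries.constantCoeff (V.map (algebraMap ONine KNine)) = 0 := by
    rw [MvPowerSeries.constantCoeff_map, hV0, map_zero]
  have hUV' : (3 : MvPowerSeries σ ONine) ∣ U - V := by
    rwa [show (3 : MvPowerSeries σ ONine) = MvPowerSeries.C (3 : ONine) from (map_ofNat _ 3).symm]
  rw [map_sub, mvCoeff_subst_eq_sum_ring hU0', mvCoeff_subst_eq_sum_ring hV0', ← Finset.sum_sub_distrib,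
    Finset.mul_sum]
  refine IsIntegral.sum _ fun m _ ↦ ?_
  rw [← mul_sub, ← map_pow, ← map_pow, ← map_sub, ← map_sub]
  obtain ⟨w, hw⟩ := natCast_mul_dvd_pow_sub_pow (R := MvPowerSeries σ ONine) (p := 3) (by norm_num)
    (fun _ hr => isUnit_natCast_mvPowerSeries_ONine hr) hUV' m
  rw [hw, show ((m : MvPowerSeries σ ONine) * ((3 : ℕ) : MvPowerSeries σ ONine)) = MvPowerSeries.C ((m : ONine) * 3) by
      rw [map_mul, map_natCast, map_ofNat, Nat.cast_ofNat], MvPowerSeries.coeff_map, MvPowerSeries.coeff_C_mul,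
    map_mul]
  have e : (3 : KNine) ^ B * (PowerSeries.coeff m f * (algebraMap ONine KNine ((m : ONine) * 3) *
      algebraMap ONine KNine (MvPowerSeries.coeff d w))) =
      ((3 : KNine) ^ B * ((m : KNine) * PowerSeries.coeff m f)) * (3 * algebraMap ONine KNine (MvPowerSeries.coeff d w)) := by
    rw [map_mul, map_natCast, map_ofNat]; ring
  rw [e]
  refine (hf m).mul (IsIntegral.mul ?_ (MvPowerSeries.coeff d w).2)
  rw [show (3 : KNine) = algebraMap ℤ_[3] KNine 3 by rw [map_ofNat]]
  exact isIntegral_algebraMap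

/-- **Substituting `𝓞`-series preserves `3ᴮ`-integrality**: if `3ᴮ·Φ ∈ 𝓞⟦X,Y⟧ ⊗ L` coefficientwise then so is
`3ᴮ·Φ(s₀, s₁)` for `s₀, s₁ ∈ 𝓞⟦τ⟧` without constant term (`Φ(s) = (3^{−B}Ψ)(s)`, `Ψ(s) ∈ 𝓞⟦τ⟧`). [folklore] -/
theorem isIntegral_coeff_mvSubst_of_map {τ : Type*} {Φ : MvPowerSeries (Fin 2) KNine} {B : ℕ}
    (hΦ : ∀ d, IsIntegral ℤ_[3] ((3 : KNine) ^ B * MvPowerSeries.coeff d Φ))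
    {s : Fin 2 → MvPowerSeries τ ONine} (hs : ∀ i, MvPowerSeries.constantCoeff (s i) = 0) (e : τ →₀ ℕ) :
    IsIntegral ℤ_[3] ((3 : KNine) ^ B * MvPowerSeries.coeff e
      (Φ.subst (fun i ↦ (s i).map (algebraMap ONine KNine)))) := by
  obtain ⟨Ψ, hΨ⟩ := exists_eq_map_of_isIntegral (Φ := ((3 : KNine) ^ B) • Φ)
    (fun d ↦ by rw [map_smul, smul_eq_mul]; exact hΦ d)
  have hsO : MvPowerSeries.HasSubst s := MvPowerSeries.hasSubst_of_constantCoeff_zero hs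
  have hsK : MvPowerSeries.HasSubst (fun i ↦ (s i).map (algebraMap ONine KNine)) :=
    MvPowerSeries.hasSubst_of_constantCoeff_zero fun i ↦ by rw [MvPowerSeries.constantCoeff_map, hs i, map_zero]
  have e1 : (3 : KNine) ^ B * MvPowerSeries.coeff e (Φ.subst (fun i ↦ (s i).map (algebraMap ONine KNine))) =
      MvPowerSeries.coeff e ((Ψ.subst s).map (algebraMap ONine KNine)) := by
    rw [MvPowerSeries.map_subst hsO, hΨ, MvPowerSeries.subst_smul hsK, map_smul, smul_eq_mul]
  rw [e1]
  exact isIntegral_coeff_map_ONine _ e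

/-! ## §2 `f ∘ ν` is a class of `D(V̂₀ ⊗ 𝓞/𝓞)_ℚ` -/

/-- **`d(f ∘ ν)` has `3^{−B}`-bounded denominators**: `(n+1)·[z^{n+1}](f∘ν) = [zⁿ]((f′∘ν)·ν′)` and `3ᴮ f′ ∈ 𝓞⟦z⟧ ⊗ L`.
[cite: Katz1981CrystallineDieudonne, §5 Thm 5.1.4] -/
theorem isIntegral_natCast_mul_coeff_subst_verschiebung {f : KNine⟦X⟧} {B : ℕ}
    (hf : ∀ n : ℕ, IsIntegral ℤ_[3] ((3 : KNine) ^ B * ((n : KNine) * PowerSeries.coeff n f)))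
    {ν : ONine⟦X⟧} (hν0 : PowerSeries.constantCoeff ν = 0) (n : ℕ) :
    IsIntegral ℤ_[3] ((3 : KNine) ^ B * ((n : KNine) *
      PowerSeries.coeff n (f.subst (PowerSeries.map (algebraMap ONine KNine) ν)))) := by
  rcases n with _ | n
  · rw [Nat.cast_zero, zero_mul, mul_zero]; exact isIntegral_zero
  set νK := PowerSeries.map (algebraMap ONine KNine) ν with hνK
  have hνK0 : PowerSeries.constantCoeff νK = 0 := by
    rw [hνK, ← PowerSeries.coeff_zero_eq_constantCoeff_apply, PowerSeries.coeff_map,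
      PowerSeries.coeff_zero_eq_constantCoeff_apply, hν0, map_zero]
  have hsK : PowerSeries.HasSubst νK := PowerSeries.HasSubst.of_constantCoeff_zero' hνK0
  -- `3^B f'` comes from `𝓞`
  obtain ⟨F₁, hF₁⟩ := exists_eq_map_of_isIntegral' (φ := ((3 : KNine) ^ B) • d⁄dX KNine f) (fun k ↦ by
    rw [PowerSeries.coeff_smul, PowerSeries.coeff_derivative, smul_eq_mul,
      show PowerSeries.coeff (k + 1) f * ((k : KNine) + 1) = (((k + 1 : ℕ) : KNine) * PowerSeries.coeff (k + 1) f) by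
        push_cast; ring]
    exact hf (k + 1))
  have e1 : (3 : KNine) ^ B * ((((n + 1 : ℕ) : KNine)) * PowerSeries.coeff (n + 1) (f.subst νK)) =
      PowerSeries.coeff n (PowerSeries.map (algebraMap ONine KNine) (F₁.subst ν * d⁄dX ONine ν)) := by
    rw [map_mul, WeierstrassCurve.powerSeries_map_subst _ (PowerSeries.HasSubst.of_constantCoeff_zero' hν0), hF₁,
      ← derivative_map_eq, ← hνK, PowerSeries.subst_smul hsK, smul_mul_assoc, ← PowerSeries.derivative_subst KNine hsK,
      PowerSeries.coeff_smul, PowerSeries.coeff_derivative, smul_eq_mul]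
    push_cast; ring
  rw [e1, PowerSeries.coeff_map]
  exact (PowerSeries.coeff n (F₁.subst ν * d⁄dX ONine ν)).2

/-- **`∂_{G₀}(f ∘ ν)` is `3^{−B}`-integral** (`G₀` = the `ℤ₃`-lift's group law read over `𝓞`): with `U = ν(G₀)`,
`V = Ĝ(ν X, ν Y)` (congruent mod `3` by `verschiebung_hom_mod_three`),
`∂_{G₀}(f∘ν) = [f(U) − f(V)] + (∂_Ĝ f)(ν X, ν Y)` — Key Lemma + substitution. This is Katz's Theorem 5.1.4 for the pointed
map `ν : V̂₀ ⊗ 𝓞 → Ê` and the divided-power ideal `(3)`. [cite: Katz1981CrystallineDieudonne, §5 Thm 5.1.4] -/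
theorem isIntegral_coeff_coboundary_verschiebung {ϖ : ONine} (hϖ : (3 : ONine) ∣ ϖ ^ 6) {E : WeierstrassCurve ONine}
    {V₀ : WeierstrassCurve ℤ_[3]}
    (hEV : E.map (Ideal.Quotient.mk (Ideal.span {ϖ})) =
      (V₀.map (algebraMap ℤ_[3] ONine)).map (Ideal.Quotient.mk (Ideal.span {ϖ})))
    {ν : ONine⟦X⟧} (hν0 : PowerSeries.constantCoeff ν = 0)
    (hν : PowerSeries.map (Ideal.Quotient.mk (Ideal.span {(3 : ONine)})) (E.formalNeg.subst (E.formalMul 9)) =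
      PowerSeries.map (Ideal.Quotient.mk (Ideal.span {(3 : ONine)})) (PowerSeries.expand 9 (by norm_num) ν))
    {f : KNine⟦X⟧} {B : ℕ}
    (hfd : ∀ n : ℕ, IsIntegral ℤ_[3] ((3 : KNine) ^ B * ((n : KNine) * PowerSeries.coeff n f)))
    (hfc : ∀ d, IsIntegral ℤ_[3] ((3 : KNine) ^ B * MvPowerSeries.coeff d
      (f.subst (E.map (algebraMap ONine KNine)).formalGroupLaw -
        f.subst (MvPowerSeries.X 0 : MvPowerSeries (Fin 2) KNine) -
        f.subst (MvPowerSeries.X 1 : MvPowerSeries (Fin 2) KNine))))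
    (d : Fin 2 →₀ ℕ) :
    IsIntegral ℤ_[3] ((3 : KNine) ^ B * MvPowerSeries.coeff d
      (PowerSeries.subst (((V₀.map (algebraMap ℤ_[3] ONine)).formalGroupLaw).map (algebraMap ONine KNine))
          (f.subst (PowerSeries.map (algebraMap ONine KNine) ν)) -
        PowerSeries.subst (MvPowerSeries.X 0 : MvPowerSeries (Fin 2) KNine)
          (f.subst (PowerSeries.map (algebraMap ONine KNine) ν)) -
        PowerSeries.subst (MvPowerSeries.X 1 : MvPowerSeries (Fin 2) KNine)
          (f.subst (PowerSeries.map (algebraMap ONine KNine) ν)))) := by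
  set ι := algebraMap ONine KNine with hι
  set νK := PowerSeries.map ι ν with hνK
  set G := E.formalGroupLaw with hG
  set GK := (E.map ι).formalGroupLaw with hGK
  set G₀ := (V₀.map (algebraMap ℤ_[3] ONine)).formalGroupLaw with hG₀
  set s : Fin 2 → MvPowerSeries (Fin 2) ONine := fun i ↦ ν.subst (MvPowerSeries.X i) with hs
  set U := ν.subst G₀ with hU
  set V := MvPowerSeries.subst s G with hV
  have hG0c : MvPowerSeries.constantCoeff G = 0 := E.constantCoeff_formalGroupLaw
  have hGK0c : MvPowerSeries.constantCoeff GK = 0 := (E.map ι).constantCoeff_formalGroupLaw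
  have hG₀0c : MvPowerSeries.constantCoeff G₀ = 0 := WeierstrassCurve.constantCoeff_formalGroupLaw _
  have hG₀K0c : MvPowerSeries.constantCoeff (G₀.map ι) = 0 := by
    rw [MvPowerSeries.constantCoeff_map, hG₀0c, map_zero]
  have hs0 : ∀ i, MvPowerSeries.constantCoeff (s i) = 0 := fun i ↦
    PowerSeries.constantCoeff_subst_eq_zero (MvPowerSeries.constantCoeff_X i) _ hν0
  have hsO : MvPowerSeries.HasSubst s := MvPowerSeries.hasSubst_of_constantCoeff_zero hs0
  have hsK : MvPowerSeries.HasSubst (fun i ↦ (s i).map ι) :=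
    MvPowerSeries.hasSubst_of_constantCoeff_zero fun i ↦ by rw [MvPowerSeries.constantCoeff_map, hs0 i, map_zero]
  have hU0 : MvPowerSeries.constantCoeff U = 0 := PowerSeries.constantCoeff_subst_eq_zero hG₀0c _ hν0
  have hV0 : MvPowerSeries.constantCoeff V = 0 := MvPowerSeries.constantCoeff_subst_eq_zero hsO hs0 hG0c
  have hνK0 : PowerSeries.constantCoeff νK = 0 := by
    rw [hνK, ← PowerSeries.coeff_zero_eq_constantCoeff_apply, PowerSeries.coeff_map,
      PowerSeries.coeff_zero_eq_constantCoeff_apply, hν0, map_zero]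
  have hνKs : PowerSeries.HasSubst νK := PowerSeries.HasSubst.of_constantCoeff_zero' hνK0
  -- `U ≡ V (mod 3)`: the Verschiebung lift is a homomorphism mod `3`
  have hUV : MvPowerSeries.C (3 : ONine) ∣ U - V := by
    rw [C_dvd_iff_forall_dvd_coeff, ← map_mk_eq_map_mk_iff]
    exact verschiebung_hom_mod_three hϖ hEV hν0 hν
  -- the three substitutions of `g = f ∘ νK`
  have e1 : PowerSeries.subst (G₀.map ι) (f.subst νK) = f.subst (U.map ι) := by
    rw [PowerSeries.subst_comp_subst_apply hνKs (PowerSeries.HasSubst.of_constantCoeff_zero hG₀K0c), hU,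
      PowerSeries.map_subst (PowerSeries.HasSubst.of_constantCoeff_zero hG₀0c)]
  have e2 : ∀ i : Fin 2, PowerSeries.subst (MvPowerSeries.X i : MvPowerSeries (Fin 2) KNine) (f.subst νK) =
      f.subst ((s i).map ι) := by
    intro i
    rw [PowerSeries.subst_comp_subst_apply hνKs (PowerSeries.HasSubst.X i), hs]
    change _ = f.subst (MvPowerSeries.map ι (ν.subst (MvPowerSeries.X i)))
    rw [PowerSeries.map_subst (PowerSeries.HasSubst.X i), MvPowerSeries.map_X]
  -- `V`, read over `L`, is `Ĝ(ν X, ν Y)`; the `Ĝ`-coboundary substituted there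
  have hVK : V.map ι = MvPowerSeries.subst (fun i ↦ (s i).map ι) GK := by
    rw [hV, MvPowerSeries.map_subst hsO, hG, WeierstrassCurve.map_formalGroupLaw]
  have hGKs : PowerSeries.HasSubst GK := PowerSeries.HasSubst.of_constantCoeff_zero hGK0c
  have e3 : MvPowerSeries.subst (fun i ↦ (s i).map ι)
      (f.subst GK - f.subst (MvPowerSeries.X 0 : MvPowerSeries (Fin 2) KNine) -
        f.subst (MvPowerSeries.X 1 : MvPowerSeries (Fin 2) KNine)) =
      f.subst (V.map ι) - f.subst ((s 0).map ι) - f.subst ((s 1).map ι) := by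
    rw [MvPowerSeries.subst_sub hsK, MvPowerSeries.subst_sub hsK, mvSubst_powerSeries_subst hGKs hsK,
      mvSubst_powerSeries_subst (PowerSeries.HasSubst.X 0) hsK, mvSubst_powerSeries_subst (PowerSeries.HasSubst.X 1) hsK,
      MvPowerSeries.subst_X hsK, MvPowerSeries.subst_X hsK, hVK]
  have key : PowerSeries.subst (G₀.map ι) (f.subst νK) -
      PowerSeries.subst (MvPowerSeries.X 0 : MvPowerSeries (Fin 2) KNine) (f.subst νK) -
      PowerSeries.subst (MvPowerSeries.X 1 : MvPowerSeries (Fin 2) KNine) (f.subst νK) =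
      (f.subst (U.map ι) - f.subst (V.map ι)) +
        MvPowerSeries.subst (fun i ↦ (s i).map ι)
          (f.subst GK - f.subst (MvPowerSeries.X 0 : MvPowerSeries (Fin 2) KNine) -
            f.subst (MvPowerSeries.X 1 : MvPowerSeries (Fin 2) KNine)) := by
    rw [e1, e2 0, e2 1, e3]; ring
  rw [key, map_add, mul_add]
  exact (isIntegral_mvCoeff_subst_sub_subst_K hfd hU0 hV0 hUV d).add (isIntegral_coeff_mvSubst_of_map hfc hs0 d)

end Summit.BirchSwinnertonDyer.BirchSwinnertonDyer.Theorems.DescendedFrobeniusTransfer
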